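import Literature.NumberTheory.Automorphic.GaloisActionPlaces
import Mathlib.NumberTheory.RamificationInertia.Galois
import Mathlib.FieldTheory.Finite.GaloisField
import Mathlib.NumberTheory.NumberField.Norm
import Mathlib.NumberTheory.NumberField.Ideal.Basic
import Mathlib.RingTheory.DedekindDomain.Ideal.Lemmas
import HarnessLib

/-!
# Norms of units modulo an unramified prime of a Galois extension are surjective

Topic `NumberTheory/GaloisRepresentations` (class field theory: the residue-field step of
Childress, *Class Field Theory*, Ch. 4 §5 Lemma 5.3 (a), "the norm map on the units of an
unramified extension is surjective", PDF p. 95); namespace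
`Literature.NumberTheory.GaloisRepresentations.ResidueNorm`.  Everything **proved**.

* `ResidueNorm.exists_norm_sub_mem` — for a finite Galois extension of number fields `E/F`, a
  finite place `v` of `F` **unramified** in `E` (`v.asIdeal.ramificationIdxIn (𝓞 E) = 1`) and
  `c ∈ 𝓞 F` prime to `v`, there is `β ∈ 𝓞 E` prime to every place above `v` with
  `N_{E/F}(β) ≡ c (mod 𝔭_v)`.  Proof: at a prime `𝔓 ∣ 𝔭_v` the decomposition group maps
  isomorphically (unramified: inertia trivial) onto `Gal(k_𝔓/k_v)` (Mathlib
  `Ideal.Quotient.stabilizerHom`, `stabilizerHom_surjective`, `card_inertia_eq_ramificationIdxIn`),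
  the norm of finite fields is surjective (Mathlib `FiniteField.unitsMap_norm_surjective`), and a
  `β` congruent to a preimage modulo `𝔓` and to `1` modulo the other primes above `𝔭_v` (CRT) has
  `N_{E/F}(β) = ∏_σ σβ ≡ N_{k_𝔓/k_v}(β̄) (mod 𝔓)`.

## References

* N. Childress, *Class Field Theory*, Universitext, Springer 2009, Ch. 4 §5 Lemma 5.3 (PDF p. 95).
  [Childress2009]
* J. W. S. Cassels, A. Fröhlich (eds.), *Algebraic Number Theory* (1967), Ch. I §7 (unramified
  extensions: norm on units surjective). [CasselsFrohlichANT1967]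
-/

noncomputable section

open NumberField IsDedekindDomain

namespace Literature.NumberTheory.GaloisRepresentations

namespace ResidueNorm

open Literature.NumberTheory.Automorphic

attribute [local instance] Ideal.Quotient.field

open scoped Pointwise

variable {F : Type*} [Field F] [NumberField F] {E : Type*} [Field E] [NumberField E] [Algebra F E]

/-- `N_{E/F}(β) = ∏_σ σ β` inside `𝓞 E` for `E/F` Galois. [folklore] -/
theorem algebraMap_norm_eq_prod [IsGalois F E] (β : 𝓞 E) :
    algebraMap (𝓞 F) (𝓞 E) (RingOfIntegers.norm F β) = ∏ σ : E ≃ₐ[F] E, σ • β := by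
  apply RingOfIntegers.ext
  rw [RingOfIntegers.coe_algebraMap_norm, Algebra.norm_eq_prod_automorphisms]
  push_cast
  rfl

/-- **Childress Lemma 5.3 (a), residue-field step (global form).**  Let `E/F` be a finite Galois
extension of number fields, `v` a finite place of `F` unramified in `E`, and `c ∈ 𝓞 F`, `c ∉ 𝔭_v`.
Then there is `β ∈ 𝓞 E`, a unit at every place above `v`, with `N_{E/F}(β) - c ∈ 𝔭_v`.
[cite: Childress2009, Ch. 4 §5 Lemma 5.3 (PDF p. 95)] -/
theorem exists_norm_sub_mem [IsGalois F E] (v : HeightOneSpectrum (𝓞 F))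
    (hunr : v.asIdeal.ramificationIdxIn (𝓞 E) = 1) (c : 𝓞 F) (hc : c ∉ v.asIdeal) :
    ∃ β : 𝓞 E, (∀ w : HeightOneSpectrum (𝓞 E), w.under (𝓞 F) = v → β ∉ w.asIdeal) ∧
      RingOfIntegers.norm F β - c ∈ v.asIdeal := by
  classical
  -- a prime above `v`
  obtain ⟨Q₀, hQ₀m, hQ₀⟩ := Ideal.exists_maximal_ideal_liesOver_of_isIntegral (S := 𝓞 E) v.asIdeal
  haveI : Q₀.IsMaximal := hQ₀m
  haveI : Q₀.LiesOver v.asIdeal := hQ₀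
  have hQ₀ne : Q₀ ≠ ⊥ := Ideal.ne_bot_of_liesOver_of_ne_bot v.ne_bot Q₀
  set w₀ : HeightOneSpectrum (𝓞 E) := ⟨Q₀, hQ₀m.isPrime, hQ₀ne⟩ with hw₀def
  have hw₀v : w₀.under (𝓞 F) = v := HeightOneSpectrum.ext (Ideal.LiesOver.over (P := Q₀) (p := v.asIdeal)).symm
  haveI : v.asIdeal.IsMaximal := v.isMaximal
  -- residue fields
  set k := 𝓞 F ⧸ v.asIdeal
  set k' := 𝓞 E ⧸ Q₀
  set G := E ≃ₐ[F] E
  -- the unit `c̄` and a preimage under the norm of finite fields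
  have hc0 : (Ideal.Quotient.mk v.asIdeal c : k) ≠ 0 := fun h => hc (Ideal.Quotient.eq_zero_iff_mem.mp h)
  obtain ⟨xu, hxu⟩ := FiniteField.unitsMap_norm_surjective k k' (Units.mk0 _ hc0)
  obtain ⟨β₀, hβ₀⟩ := Ideal.Quotient.mk_surjective (xu : k')
  have hβ₀Q : β₀ ∉ Q₀ := fun h => by
    have : (xu : k') = 0 := by rw [← hβ₀]; exact Ideal.Quotient.eq_zero_iff_mem.mpr h
    exact xu.ne_zero this
  -- CRT: `β ≡ β₀ (Q₀)`, `β ≡ 1` at the other places above `v`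
  set T : Finset (HeightOneSpectrum (𝓞 E)) :=
    (IsDedekindDomain.primesOver_finite v.asIdeal (𝓞 E)).toFinset.preimage HeightOneSpectrum.asIdeal
      (fun w _ w' _ h => HeightOneSpectrum.ext h) with hTdef
  have hmemT : ∀ w : HeightOneSpectrum (𝓞 E), w ∈ T ↔ w.under (𝓞 F) = v := by
    intro w
    rw [hTdef, Finset.mem_preimage, Set.Finite.mem_toFinset]
    constructor
    · rintro ⟨_, hover⟩
      exact HeightOneSpectrum.ext hover.over.symm
    · intro h
      exact ⟨w.isPrime, ⟨by rw [← h]; rfl⟩⟩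
  obtain ⟨β, hβ⟩ := IsDedekindDomain.exists_forall_sub_mem_ideal (s := T) (fun w => w.asIdeal) (fun _ => 1)
    (fun w _ => w.prime) (fun w _ w' _ hne h => hne (HeightOneSpectrum.ext h))
    (fun w => if (w : HeightOneSpectrum (𝓞 E)) = w₀ then β₀ else 1)
  have hw₀T : w₀ ∈ T := (hmemT w₀).mpr hw₀v
  have hβ₀' : β - β₀ ∈ Q₀ := by
    have := hβ w₀ hw₀T
    simp only [↓reduceIte, pow_one] at this
    exact this
  have hβ1 : ∀ w ∈ T, w ≠ w₀ → β - 1 ∈ w.asIdeal := fun w hw hne => by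
    have := hβ w hw
    simp only [hne, ↓reduceIte, pow_one] at this
    exact this
  refine ⟨β, fun w hw => ?_, ?_⟩
  · -- `β` is a unit above `v`
    have hwT : w ∈ T := (hmemT w).mpr hw
    by_cases hne : w = w₀
    · subst hne
      intro hβQ
      exact hβ₀Q (by simpa using Q₀.sub_mem hβQ hβ₀')
    · intro hβw
      have : (1 : 𝓞 E) ∈ w.asIdeal := by simpa using w.asIdeal.sub_mem hβw (hβ1 w hwT hne)
      exact w.isPrime.ne_top ((Ideal.eq_top_iff_one _).mpr this)
  · -- the norm congruence, computed modulo `Q₀`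
    -- decomposition group ≅ residue Galois group (unramified)
    have hinj : Function.Injective (Ideal.Quotient.stabilizerHom Q₀ v.asIdeal G) := by
      have h1 : (Ideal.Quotient.stabilizerHom Q₀ v.asIdeal G).ker.map (Subgroup.subtype _) = ⊥ := by
        rw [Ideal.Quotient.map_ker_stabilizer_subtype]
        apply Subgroup.eq_bot_of_card_eq
        rw [Ideal.card_inertia_eq_ramificationIdxIn (G := G) v.asIdeal Q₀, hunr]
      exact (MonoidHom.ker_eq_bot_iff _).mp
        ((Subgroup.map_eq_bot_iff_of_injective _ (Subgroup.subtype_injective _)).mp h1)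
    have hbij : Function.Bijective (Ideal.Quotient.stabilizerHom Q₀ v.asIdeal G) :=
      ⟨hinj, Ideal.Quotient.stabilizerHom_surjective G v.asIdeal Q₀⟩
    -- `σ β mod Q₀`
    have hmod : ∀ σ : G, Ideal.Quotient.mk Q₀ (σ • β) =
        if hσ : σ ∈ MulAction.stabilizer G Q₀ then
          Ideal.Quotient.stabilizerHom Q₀ v.asIdeal G ⟨σ, hσ⟩ (Ideal.Quotient.mk Q₀ β₀) else 1 := by
      intro σ
      split_ifs with hσ
      · rw [Ideal.Quotient.stabilizerHom_apply, Subgroup.mk_smul, Ideal.Quotient.eq]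
        rw [← smul_sub]
        have : σ • (β - β₀) ∈ σ • Q₀ := Ideal.smul_mem_pointwise_smul_iff.mpr hβ₀'
        rwa [show σ • Q₀ = Q₀ from hσ] at this
      · -- `σ⁻¹ • w₀ ≠ w₀` lies above `v`, where `β ≡ 1`
        have hw' : (σ⁻¹ • w₀).under (𝓞 F) = v := by rw [HeightOneSpectrum.under_algEquiv_smul, hw₀v]
        have hne : σ⁻¹ • w₀ ≠ w₀ := fun h => hσ (by
          have := congrArg HeightOneSpectrum.asIdeal h
          rw [HeightOneSpectrum.smul_asIdeal] at this
          rw [MulAction.mem_stabilizer_iff]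
          have h2 := congrArg (fun I => σ • I) this
          simp only [smul_inv_smul] at h2
          exact h2.symm)
        have h1 := hβ1 _ ((hmemT _).mpr hw') hne
        rw [HeightOneSpectrum.smul_asIdeal] at h1
        have : σ • (β - 1) ∈ σ • (σ⁻¹ • Q₀) := Ideal.smul_mem_pointwise_smul_iff.mpr h1
        rw [smul_inv_smul, smul_sub, smul_one] at this
        rw [← (Ideal.Quotient.mk Q₀).map_one, Ideal.Quotient.eq]
        exact this
    -- the product over `G`
    have hprod : Ideal.Quotient.mk Q₀ (∏ σ : G, σ • β) =
        algebraMap k k' (Algebra.norm k (Ideal.Quotient.mk Q₀ β₀)) := by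
      rw [map_prod, Algebra.norm_eq_prod_automorphisms,
        ← (Equiv.ofBijective _ hbij).prod_comp (fun τ => τ (Ideal.Quotient.mk Q₀ β₀))]
      simp only [Equiv.ofBijective_apply]
      -- restrict the product over `G` to the stabilizer (the other factors are `1`)
      rw [← Finset.prod_subset (Finset.subset_univ (Finset.univ.filter (· ∈ MulAction.stabilizer G Q₀)))
        (fun σ _ hσ => by
          rw [Finset.mem_filter, not_and] at hσ
          rw [hmod σ, dif_neg (hσ (Finset.mem_univ σ))])]
      rw [Finset.prod_subtype (Finset.univ.filter (· ∈ MulAction.stabilizer G Q₀))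
        (p := (· ∈ MulAction.stabilizer G Q₀)) (fun σ => by simp)]
      refine Finset.prod_congr rfl fun σ _ => ?_
      rw [hmod σ, dif_pos σ.2]
    -- conclude modulo `Q₀ ∩ 𝓞 F = 𝔭_v`
    have hnormQ : algebraMap (𝓞 F) (𝓞 E) (RingOfIntegers.norm F β - c) ∈ Q₀ := by
      rw [map_sub, algebraMap_norm_eq_prod, ← Ideal.Quotient.eq, hprod]
      have hn : Algebra.norm k (Ideal.Quotient.mk Q₀ β₀) = Ideal.Quotient.mk v.asIdeal c := by
        have := congrArg (fun u : kˣ => (u : k)) hxu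
        simp only [Units.coe_map, Units.val_mk0] at this
        rw [← this, ← hβ₀]
      rw [hn]
      rfl
    have : RingOfIntegers.norm F β - c ∈ Q₀.comap (algebraMap (𝓞 F) (𝓞 E)) := hnormQ
    rwa [← Ideal.under_def, ← Ideal.LiesOver.over (P := Q₀) (p := v.asIdeal)] at this

end ResidueNorm

end Literature.NumberTheory.GaloisRepresentations
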